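import Summits.CriticalPhenomena.PercolationContinuityZ3.Theorems.PercNearOneGluingNoHeavyLowerTailTformStarPackingReduction
import HarnessLib

/-!
# `NoHeavyLowerTail` (stmt-CriticalPhenomena-4575) — the SHARPENED light-star packing law SLSP2 (runner-up weight) as a typed
# conjecture: SLSP2 ⇒ LSP ⇒ the crux

Support file (prover `prim-hp-5`, hull-port cell, T-form calculus, gen 3; `--supports stmt-CriticalPhenomena-4575`).
No definitions, no named facts, no sorries.  `μ = prodBernoulli u` on `Fin n`, relays `A`, level `j`, champion `q`, relay `c`, nonempty
set `B` of non-relay vertices, `M_B = |π(B)|`, `X = μ(q ≁ B, 1 ≤ M_B ≤ j)`, `R_T = μ(q ≁ B, 1 ≤ M_B, |π(q)| ≤ j)`,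
`ν(x) = μ(M_B = 0, |π(x)| ≤ j)`, `Φ(x) = μ{|π(x)| ≤ j}`.

LSP (`Theorems.attachedChampion_of_lightStarPacking`) reads `X + ν(c) ≤ R_T + ν(q)`.  The ttrl census of LSP (`run/shared/lean/ttrl/tcs/LSP.md`,
coordinator relay 2026-08-19T15:08Z: 0 violations / 6 229 216 exact triples `n ≤ 6`, equality only at `c = q` or champion ties) found the
SHARPENED form with the runner-up weight, as for TCS/STCS2:

  **SLSP2:**  `Φ(q) · (X + ν(c) − ν(q)) ≤ Φ(a₂) · R_T`,   `a₂` = the runner-up relay   (0 / 1 060 392 unique-champion triples, 68 821 equalities;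
  at `c = q` it is STCS2; the `Φ(c)`-weighted variant is false).

This file states SLSP2 as a typed hypothesis with a free admissible runner-up bound `t` (`Φ(a) ≤ t` for `a ≠ q`, `0 ≤ t ≤ Φ(q)`; `t = Φ(a₂)` is
SLSP2 verbatim, larger `t` only weakens it — the binder shape of `Theorems.noHeavyLowerTail_of_sharpTCS`) and records the implications:
* `lightStarPacking_of_sharp` — SLSP2 (all admissible `t`) ⇒ LSP (take `t = Φ(q)` and divide; the case `Φ(q) = 0` is direct: every relay is
  a.s. heavy, so `X = 0` because a relay joined to `B` carries at most `M_B` relays, and `ν(c) ≤ Φ(c) = 0`).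
* `noHeavyLowerTail_of_sharpLightStarPacking` — SLSP2 ⇒ `NoHeavyLowerTail` (via `Theorems.noHeavyLowerTail_of_lightStarPacking`).
-/

noncomputable section

namespace Summit.CriticalPhenomena.PercolationContinuityZ3.Theorems

open MeasureTheory Set Literature.Probability.LatticeModels Literature.Probability.Percolation
open scoped Classical BigOperators

/-- **SLSP2 (all admissible runner-up bounds) implies LSP.**  Hypothesis `hSLSP`: for every weighted graph, relays `A`, `q, c ∈ A`, nonempty
non-relay `B`, level `j` and `t` with `0 ≤ t`, `Φ(a) ≤ t` for all relays `a ≠ q`, `t ≤ Φ(q)`: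
`Φ(q)·(μ(q ≁ B, 1 ≤ M_B ≤ j) + μ(M_B = 0, |π(c)| ≤ j) − μ(M_B = 0, |π(q)| ≤ j)) ≤ t·μ(q ≁ B, 1 ≤ M_B, |π(q)| ≤ j)`.
Conclusion: the LSP binder of `Theorems.attachedChampion_of_lightStarPacking`. [this file] -/
theorem lightStarPacking_of_sharp
    (hSLSP : ∀ (n : ℕ) (u : Sym2 (Fin n) → unitInterval) (A B : Finset (Fin n)) (q c : Fin n) (j : ℕ) (t : ℝ),
      q ∈ A → c ∈ A → B.Nonempty → (∀ y ∈ B, y ∉ A) → 0 ≤ t →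
      (∀ a ∈ A, a ≠ q → (prodBernoulli u).real {ξ : BondConfig (Fin n) | (A.filter fun z => (openGraph ξ).Reachable a z).card ≤ j} ≤ t) →
      t ≤ (prodBernoulli u).real {ξ : BondConfig (Fin n) | (A.filter fun z => (openGraph ξ).Reachable q z).card ≤ j} →
      (prodBernoulli u).real {ξ : BondConfig (Fin n) | (A.filter fun z => (openGraph ξ).Reachable q z).card ≤ j} *
        ((prodBernoulli u).real {ξ : BondConfig (Fin n) |
            (∀ y ∈ B, ¬ (openGraph ξ).Reachable q y) ∧
              1 ≤ (A.filter fun z => ∃ y ∈ B, (openGraph ξ).Reachable y z).card ∧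
              (A.filter fun z => ∃ y ∈ B, (openGraph ξ).Reachable y z).card ≤ j} +
          (prodBernoulli u).real {ξ : BondConfig (Fin n) |
            ¬ 1 ≤ (A.filter fun z => ∃ y ∈ B, (openGraph ξ).Reachable y z).card ∧
              (A.filter fun z => (openGraph ξ).Reachable c z).card ≤ j} -
          (prodBernoulli u).real {ξ : BondConfig (Fin n) |
            ¬ 1 ≤ (A.filter fun z => ∃ y ∈ B, (openGraph ξ).Reachable y z).card ∧
              (A.filter fun z => (openGraph ξ).Reachable q z).card ≤ j}) ≤
      t * (prodBernoulli u).real {ξ : BondConfig (Fin n) |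
            (∀ y ∈ B, ¬ (openGraph ξ).Reachable q y) ∧
              1 ≤ (A.filter fun z => ∃ y ∈ B, (openGraph ξ).Reachable y z).card ∧
              (A.filter fun z => (openGraph ξ).Reachable q z).card ≤ j}) :
    ∀ (n : ℕ) (u : Sym2 (Fin n) → unitInterval) (A B : Finset (Fin n)) (q c : Fin n) (j : ℕ),
      q ∈ A → c ∈ A → B.Nonempty → (∀ y ∈ B, y ∉ A) →
      (∀ a ∈ A, (prodBernoulli u).real {ξ : BondConfig (Fin n) | (A.filter fun z => (openGraph ξ).Reachable a z).card ≤ j} ≤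
        (prodBernoulli u).real {ξ : BondConfig (Fin n) | (A.filter fun z => (openGraph ξ).Reachable q z).card ≤ j}) →
      (prodBernoulli u).real {ξ : BondConfig (Fin n) |
          (∀ y ∈ B, ¬ (openGraph ξ).Reachable q y) ∧
            1 ≤ (A.filter fun z => ∃ y ∈ B, (openGraph ξ).Reachable y z).card ∧
            (A.filter fun z => ∃ y ∈ B, (openGraph ξ).Reachable y z).card ≤ j} +
        (prodBernoulli u).real {ξ : BondConfig (Fin n) |
          ¬ 1 ≤ (A.filter fun z => ∃ y ∈ B, (openGraph ξ).Reachable y z).card ∧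
            (A.filter fun z => (openGraph ξ).Reachable c z).card ≤ j} ≤
      (prodBernoulli u).real {ξ : BondConfig (Fin n) |
          (∀ y ∈ B, ¬ (openGraph ξ).Reachable q y) ∧ (A.filter fun z => (openGraph ξ).Reachable q z).card ≤ j} := by
  intro n u A B q c j hq hc hB hBA hchamp
  haveI : IsProbabilityMeasure (prodBernoulli u) := inferInstance
  set μ := prodBernoulli u with hμ
  set MB : BondConfig (Fin n) → ℕ := fun ξ => (A.filter fun z => ∃ y ∈ B, (openGraph ξ).Reachable y z).card with hMB
  set Lx : Fin n → BondConfig (Fin n) → ℕ := fun x ξ => (A.filter fun z => (openGraph ξ).Reachable x z).card with hLx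
  set Φq := μ.real {ξ : BondConfig (Fin n) | Lx q ξ ≤ j} with hΦq
  set X := μ.real {ξ | (∀ y ∈ B, ¬ (openGraph ξ).Reachable q y) ∧ 1 ≤ MB ξ ∧ MB ξ ≤ j} with hX
  set RT := μ.real {ξ | (∀ y ∈ B, ¬ (openGraph ξ).Reachable q y) ∧ 1 ≤ MB ξ ∧ Lx q ξ ≤ j} with hRT
  set νc := μ.real {ξ | ¬ 1 ≤ MB ξ ∧ Lx c ξ ≤ j} with hνc
  set νq := μ.real {ξ | ¬ 1 ≤ MB ξ ∧ Lx q ξ ≤ j} with hνq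
  change ∀ a ∈ A, μ.real {ξ : BondConfig (Fin n) | Lx a ξ ≤ j} ≤ Φq at hchamp
  change X + νc ≤ μ.real {ξ | (∀ y ∈ B, ¬ (openGraph ξ).Reachable q y) ∧ Lx q ξ ≤ j}
  -- `M_B = 0` forces `q ≁ B`; the right side splits as `R_T + ν(q)`
  have hMB0 : ∀ ξ, ¬ 1 ≤ MB ξ → ∀ y ∈ B, ¬ (openGraph ξ).Reachable q y := by
    intro ξ h y hy hqy
    exact h (Finset.card_pos.2 ⟨q, Finset.mem_filter.2 ⟨hq, y, hy, hqy.symm⟩⟩)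
  have hsplit : μ.real {ξ | (∀ y ∈ B, ¬ (openGraph ξ).Reachable q y) ∧ Lx q ξ ≤ j} = RT + νq := by
    have hunion : {ξ | (∀ y ∈ B, ¬ (openGraph ξ).Reachable q y) ∧ Lx q ξ ≤ j} =
        {ξ | (∀ y ∈ B, ¬ (openGraph ξ).Reachable q y) ∧ 1 ≤ MB ξ ∧ Lx q ξ ≤ j} ∪ {ξ | ¬ 1 ≤ MB ξ ∧ Lx q ξ ≤ j} := by
      ext ξ
      simp only [mem_union, mem_setOf_eq]
      constructor
      · rintro ⟨h1, h2⟩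
        by_cases h : 1 ≤ MB ξ
        · exact Or.inl ⟨h1, h, h2⟩
        · exact Or.inr ⟨h, h2⟩
      · rintro (⟨h1, _, h2⟩ | ⟨h, h2⟩)
        · exact ⟨h1, h2⟩
        · exact ⟨hMB0 ξ h, h2⟩
    have hdisj : Disjoint {ξ | (∀ y ∈ B, ¬ (openGraph ξ).Reachable q y) ∧ 1 ≤ MB ξ ∧ Lx q ξ ≤ j}
        {ξ | ¬ 1 ≤ MB ξ ∧ Lx q ξ ≤ j} := by
      rw [Set.disjoint_left]
      rintro ξ ⟨_, h1, _⟩ ⟨h2, _⟩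
      exact h2 h1
    rw [hunion]
    exact measureReal_union hdisj MeasurableSet.of_discrete (measure_ne_top _ _) (measure_ne_top _ _)
  rw [hsplit]
  by_cases hpos : 0 < Φq
  · -- divide the sharpened inequality at `t = Φ(q)` by `Φ(q) > 0`
    have h := hSLSP n u A B q c j Φq hq hc hB hBA measureReal_nonneg (fun a ha _ => hchamp a ha) le_rfl
    change Φq * (X + νc - νq) ≤ Φq * RT at h
    have h' : X + νc - νq ≤ RT := le_of_mul_le_mul_left h hpos
    linarith
  · -- `Φ(q) = 0`: every relay is a.s. heavy, so `X = 0` and `ν(c) = 0`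
    have hΦq0 : Φq = 0 := le_antisymm (not_lt.1 hpos) measureReal_nonneg
    have hνc0 : νc ≤ 0 := by
      calc νc ≤ μ.real {ξ : BondConfig (Fin n) | Lx c ξ ≤ j} :=
            measureReal_mono (fun ξ hξ => hξ.2) (measure_ne_top _ _)
        _ ≤ Φq := hchamp c hc
        _ = 0 := hΦq0
    have hX0 : X ≤ 0 := by
      -- a relay `z` joined to `B` carries at most `M_B` relays
      have hsub : {ξ | (∀ y ∈ B, ¬ (openGraph ξ).Reachable q y) ∧ 1 ≤ MB ξ ∧ MB ξ ≤ j} ⊆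
          ⋃ a ∈ A, {ξ : BondConfig (Fin n) | Lx a ξ ≤ j} := by
        rintro ξ ⟨_, h1, h2⟩
        obtain ⟨z, hz⟩ := Finset.card_pos.1 (lt_of_lt_of_le Nat.zero_lt_one h1)
        rw [Finset.mem_filter] at hz
        obtain ⟨hzA, y, hyB, hyz⟩ := hz
        refine mem_iUnion₂.2 ⟨z, hzA, ?_⟩
        show Lx z ξ ≤ j
        refine le_trans (Finset.card_le_card fun x hx => ?_) h2
        rw [Finset.mem_filter] at hx ⊢
        exact ⟨hx.1, y, hyB, hyz.trans hx.2⟩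
      calc X ≤ μ.real (⋃ a ∈ A, {ξ : BondConfig (Fin n) | Lx a ξ ≤ j}) := measureReal_mono hsub (measure_ne_top _ _)
        _ ≤ ∑ a ∈ A, μ.real {ξ : BondConfig (Fin n) | Lx a ξ ≤ j} := measureReal_biUnion_finset_le _ _
        _ ≤ ∑ a ∈ A, Φq := Finset.sum_le_sum fun a ha => hchamp a ha
        _ = 0 := by rw [hΦq0, Finset.sum_const_zero]
    have hRT : 0 ≤ RT := measureReal_nonneg
    have hνq : 0 ≤ νq := measureReal_nonneg
    linarith

/-- **SLSP2 closes the crux `NoHeavyLowerTail`** (via `lightStarPacking_of_sharp` and `Theorems.noHeavyLowerTail_of_lightStarPacking`). -/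
theorem noHeavyLowerTail_of_sharpLightStarPacking
    (hSLSP : ∀ (n : ℕ) (u : Sym2 (Fin n) → unitInterval) (A B : Finset (Fin n)) (q c : Fin n) (j : ℕ) (t : ℝ),
      q ∈ A → c ∈ A → B.Nonempty → (∀ y ∈ B, y ∉ A) → 0 ≤ t →
      (∀ a ∈ A, a ≠ q → (prodBernoulli u).real {ξ : BondConfig (Fin n) | (A.filter fun z => (openGraph ξ).Reachable a z).card ≤ j} ≤ t) →
      t ≤ (prodBernoulli u).real {ξ : BondConfig (Fin n) | (A.filter fun z => (openGraph ξ).Reachable q z).card ≤ j} →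
      (prodBernoulli u).real {ξ : BondConfig (Fin n) | (A.filter fun z => (openGraph ξ).Reachable q z).card ≤ j} *
        ((prodBernoulli u).real {ξ : BondConfig (Fin n) |
            (∀ y ∈ B, ¬ (openGraph ξ).Reachable q y) ∧
              1 ≤ (A.filter fun z => ∃ y ∈ B, (openGraph ξ).Reachable y z).card ∧
              (A.filter fun z => ∃ y ∈ B, (openGraph ξ).Reachable y z).card ≤ j} +
          (prodBernoulli u).real {ξ : BondConfig (Fin n) |
            ¬ 1 ≤ (A.filter fun z => ∃ y ∈ B, (openGraph ξ).Reachable y z).card ∧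
              (A.filter fun z => (openGraph ξ).Reachable c z).card ≤ j} -
          (prodBernoulli u).real {ξ : BondConfig (Fin n) |
            ¬ 1 ≤ (A.filter fun z => ∃ y ∈ B, (openGraph ξ).Reachable y z).card ∧
              (A.filter fun z => (openGraph ξ).Reachable q z).card ≤ j}) ≤
      t * (prodBernoulli u).real {ξ : BondConfig (Fin n) |
            (∀ y ∈ B, ¬ (openGraph ξ).Reachable q y) ∧
              1 ≤ (A.filter fun z => ∃ y ∈ B, (openGraph ξ).Reachable y z).card ∧
              (A.filter fun z => (openGraph ξ).Reachable q z).card ≤ j}) :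
    Summit.CriticalPhenomena.PercolationContinuityZ3.Theses.PercNearOneGluing.NoHeavyLowerTail :=
  noHeavyLowerTail_of_lightStarPacking (lightStarPacking_of_sharp hSLSP)

end Summit.CriticalPhenomena.PercolationContinuityZ3.Theorems

end
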